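import Summits.ResolutionOfSingularities.ResolutionOfSingularities.Theorems.EquisingularLiftEquisingularLiftNatTowerReachSsDefs
import HarnessLib

/-!
# T23-A⁗ «INITIAL-STAGE HYPERPLANE LETTERS» ((F4); engine word res-L1-w45b-stub-4 v2 FINAL 81913c484db62a21, desk R28/R29: the 34th) — DOWNSTAIRS CHAIN CLOSURE
# WITH A LETTER SEED (text owner res-L1-w45b-lead-2 g6): `ReachTowerBQuadPrime` (+ `reachTowerBQuadPrime_nil_iff`)

OURS · L1 W4.5(b) · EL♮(3) stmt-ResolutionOfSingularities-20148 (parent EL♮ stmt-…-20038) · counted 0 · AI-written planning vocabulary, weaker than expert review; nothing of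
[Hironaka2017] asserted; NOT a statement of the manuscript. One definition + one `Iff.rfl` (no `sorry`, no instance, no notation; standard axioms).
`--kind definition --supports stmt-ResolutionOfSingularities-20148 --as helper`.

(D⁗1) of the engine word: the A‴ chain `ReachTowerBTriplePrime` (…NatTowerReachSsDefs p628165) VERBATIM with the in-carrier seed list of later planes a PARAMETER
`Ls₂ : List (Set F₂)` instead of `[]` — the LETTERS (strict transforms of initial-stage hyperplanes through the point; their admissible shapes are stated by the residue
blob `IsoHypDefTowerBQuadPrime` in `…NatResidueHypDefs4`, at the initial Q-stage only). No new step predicate: a letter is an ordinary member of `Ps` under rules (a) away /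
(c′) through-the-point → `Ms` of `InCarrierReachKSs`, enters the round seed under the (T1)∧(T2) guard, and is an ordinary model-carrying member of the B‴ tower afterwards
(pair / fibre-pair witness or host). `ReachTowerBQuadPrime … [] … ↔ ReachTowerBTriplePrime …` is `Iff.rfl`.
-/

set_option linter.dupNamespace false

noncomputable section

open CategoryTheory CategoryTheory.Limits AlgebraicGeometry TopologicalSpace Topology IsLocalRing
open Literature.AlgebraicGeometry.Resolution
open AlgebraicGeometry.Scheme.IdealSheafData

namespace Summit.ResolutionOfSingularities.ResolutionOfSingularities.Cruxes.EquisingularLiftNat.Sections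

/-- **(D⁗1) ReachTowerBQuadPrime** — `ReachTowerBTriplePrime` VERBATIM with the in-carrier seed list of later planes a PARAMETER `Ls₂` (the letters) instead of `[]`.
Downstairs only. [OURS · T23-A⁗ Defs] -/
def ReachTowerBQuadPrime (F₁ F₂ : Scheme.{0}) (υ : F₂ ⟶ F₁) (x : F₁) (T₂ : Set F₂) (Ls₂ : List (Set F₂)) (F' : Scheme.{0}) (β : F' ⟶ F₂)
    (T' : Set F') : Prop :=
  ∃ (W : Set F₁) (K₂ : Set F₂) (F₉ : Scheme.{0}) (β₉ : F₉ ⟶ F₂) (T₉ Z₉ K₉ S₉ : Set F₉) (Ps₉ Ms₉ : List (Set F₉)) (b₉ : Bool) (hZ₉ : IsClosed Z₉)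
    (F₁₀ : Scheme.{0}) (υ' : F₁₀ ⟶ F₉) (Es₁₀ Ns₁₀ : List (Set F₁₀)) (γ' : F' ⟶ F₁₀) (E' : Set F') (Es' Ns' : List (Set F')) (K' : Set F'),
    x ∈ W ∧ ¬ (υ ⁻¹' {x} ⊆ closure (υ ⁻¹' (W \ {x}))) ∧
    (∃ U : F₁.affineOpens, x ∈ (U : F₁.Opens) ∧
      ((Scheme.IdealSheafData.vanishingIdeal (⟨closure W, isClosed_closure⟩ : Closeds F₁)).ideal U).IsPrincipal) ∧
    υ ⁻¹' {x} ∩ closure (υ ⁻¹' (W \ {x})) ⊆ T₂ ∧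
    (K₂ = ∅ ∨ (ConeForm F₁ x W ∧ K₂ = closure (υ ⁻¹' (W \ {x})))) ∧
    InCarrierReachKSs F₂ T₂ (υ ⁻¹' {x} ∩ closure (υ ⁻¹' (W \ {x}))) K₂ (υ ⁻¹' {x}) Ls₂ [] F₉ β₉ T₉ Z₉ K₉ S₉ Ps₉ Ms₉ b₉ ∧
    Z₉ ⊆ T₉ ∧ ¬ (T₉ ⊆ Z₉) ∧ Z₉.Infinite ∧
    Set.Finite {z : redSub F₉ Z₉ hZ₉ | ¬ IsRegularLocalRing ((redSub F₉ Z₉ hZ₉).presheaf.stalk z)} ∧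
    IsBlowup υ' (Scheme.IdealSheafData.vanishingIdeal (⟨Z₉, hZ₉⟩ : Closeds F₉)) ∧
    (∀ F ∈ Es₁₀, F = closure (υ' ⁻¹' (S₉ \ Z₉)) ∨
      ∃ P ∈ Ps₉, ∃ hP : IsClosed P,
        (∀ g ∈ Z₉ ∩ P, stalkIdeal (vanishingIdeal (⟨Z₉, hZ₉⟩ : Closeds F₉)) g ⊔ stalkIdeal (vanishingIdeal (⟨P, hP⟩ : Closeds F₉)) g =
            maximalIdeal (F₉.presheaf.stalk g)) ∧
        (∀ g ∈ Z₉ ∩ P, stalkIdeal (vanishingIdeal (⟨Z₉, hZ₉⟩ : Closeds F₉)) g ≠ maximalIdeal (F₉.presheaf.stalk g)) ∧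
        F = closure (υ' ⁻¹' (P \ Z₉))) ∧
    (∀ F ∈ Ns₁₀, ∃ P ∈ Ps₉ ++ Ms₉, F = closure (υ' ⁻¹' (P \ Z₉))) ∧
    (∀ R : (∀ G : Scheme.{0}, (G ⟶ F₁₀) → Set G → Set G → List (Set G) → List (Set G) → Set G → Prop),
      R F₁₀ (𝟙 F₁₀) (closure (υ' ⁻¹' (T₉ \ Z₉))) (υ' ⁻¹' Z₉) Es₁₀ Ns₁₀ (closure (υ' ⁻¹' (K₉ \ Z₉))) →
      TowerPtRegB₄ F₁₀ R → TowerPtRamB₄ F₁₀ R → TowerRoundBTriplePrime F₉ F₁₀ υ' Z₉ hZ₉ R → R F' γ' T' E' Es' Ns' K') ∧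
    β = (γ' ≫ υ') ≫ β₉

/-- No letters = the A‴ chain (definitional). [OURS · pure logic] -/
theorem reachTowerBQuadPrime_nil_iff (F₁ F₂ : Scheme.{0}) (υ : F₂ ⟶ F₁) (x : F₁) (T₂ : Set F₂) (F' : Scheme.{0}) (β : F' ⟶ F₂) (T' : Set F') :
    ReachTowerBQuadPrime F₁ F₂ υ x T₂ [] F' β T' ↔ ReachTowerBTriplePrime F₁ F₂ υ x T₂ F' β T' :=
  Iff.rfl

end Summit.ResolutionOfSingularities.ResolutionOfSingularities.Cruxes.EquisingularLiftNat.Sections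

end
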